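import Literature.Analysis.FluidPDE.AncientL3BackwardLiouville
import Literature.Analysis.FluidPDE.KNSSLiouville
import Summits.NavierStokesRegularity.NavierStokesRegularity.Theorems.HardyPointSinkNoHardyTypeIAncientWeakL3Pinning
import Summits.NavierStokesRegularity.NavierStokesRegularity.Theorems.HardyPointSinkNoHardyTypeIAncientHardyLargeScale
import Summits.NavierStokesRegularity.NavierStokesRegularity.Theorems.HardyPointSinkNoHardyTypeIAncientHardyDriftConstant
import Summits.NavierStokesRegularity.NavierStokesRegularity.Theorems.HardyPointSinkNoHardyTypeIAncientHardyOseenWindow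
import Summits.NavierStokesRegularity.NavierStokesRegularity.Theorems.HardyPointSinkNoHardyTypeIAncientOseenAncientGluing

/-!
# Route HardyPointSink — crux `NoHardyTypeIAncient` (stmt-NavierStokesRegularity-7980), line `birth`:
# the Liouville half, conditional on Albritton–Barker 2019, Thm 4.1

Summit-side proof file (stub `stub_hardyWeakL3LiouvilleOfAB41` of the registered skeleton
`Cruxes/NoHardyTypeIAncient/Lines/birth.lean`). It assembles the five landed stubs of the line
(`stub_weakL3Pinning`, `stub_hardyLargeScale`, `stub_hardyDriftConstant`, `stub_hardyOseenWindow`,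
`stub_oseenAncientGluing`) into the statement

> under the named fact `Literature.Analysis.FluidPDE.AlbrittonBarker2019_liouville_weakL3_backward`
> (Albritton–Barker 2019, Thm 4.1, case `ε = 0`, Oseen class), a bounded ancient mild solution of
> Navier–Stokes (`ν = 1`) in the tree's duality form, with measurable slices, jointly a.e.-strongly
> measurable on `(−∞, 0) × ℝ³`, Hardy-bounded about every centre at a.e. time
> (`∫ |u(t)|²/|x − x₀| ≤ K`), and bounded in weak-`L³` along negative times `τ_k → −∞`, vanishes
> a.e. on a.e. slice.

Chain: the duality-form solution has a continuous bounded ancient Oseen-mild representative `U`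
(`stub_hardyOseenWindow` on windows, `stub_oseenAncientGluing` across windows), equal to `u` a.e. on
a.e. slice and up to a spatial constant on every slice; the Hardy bound passes to every slice of `U`
(Fatou along good times, `hardyPointSink_hardyEverySlice`); the weak-`L³` bound at `τ_k` pins the
constant to `0` (`stub_weakL3Pinning`), so `U(τ_k)` is weak-`L³`-bounded; every slice `U(t₀)` lies in
Albritton–Barker's class `𝔹` (`stub_hardyLargeScale`); the fact gives `U ≡ 0` on `(−∞, t₀]` for every
`t₀ < 0`; hence `u(t) = 0` a.e. for a.e. `t`.

## References

* D. Albritton, T. Barker, J. Math. Fluid Mech. 21 (2019) no. 43 = arXiv:1811.00502, Thm 4.1.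
* G. Koch, N. Nadirashvili, G. Seregin, V. Šverák, Acta Math. 203 (2009), §1, §4.
-/

noncomputable section

set_option linter.dupNamespace false

open MeasureTheory Set Function Filter TopologicalSpace
open scoped ENNReal NNReal Topology RealInnerProductSpace

namespace Summit.NavierStokesRegularity.NavierStokesRegularity.Theorems

/-- **A.e. statements on `(−∞, 0)` hold along a sequence tending to any `t < 0`** (a full-measure
subset of `Iio 0` meets every interval `(t − 1/(n+1), t)`; squeeze). [folklore] -/
theorem hardyPointSink_exists_seq_tendsto_of_ae_Iio {P : ℝ → Prop}
    (h : ∀ᵐ s ∂(volume.restrict (Iio (0 : ℝ))), P s) {t : ℝ} (ht : t < 0) :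
    ∃ s : ℕ → ℝ, (∀ n, P (s n)) ∧ (∀ n, s n < 0) ∧ Tendsto s atTop (𝓝 t) := by
  -- in every interval `(t - 1/(n+1), t)` there is a good point
  have key : ∀ n : ℕ, ∃ s ∈ Ioo (t - 1 / ((n : ℝ) + 1)) t, P s := by
    intro n
    by_contra hcon
    simp only [not_exists, not_and] at hcon
    have hsub : Ioo (t - 1 / ((n : ℝ) + 1)) t ⊆ {s | ¬ (s ∈ Iio (0 : ℝ) → P s)} := by
      intro s hs himp
      exact hcon s hs (himp (show s ∈ Iio (0 : ℝ) from lt_trans hs.2 ht))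
    have hzero : volume {s | ¬ (s ∈ Iio (0 : ℝ) → P s)} = 0 := by
      have := (ae_restrict_iff' (measurableSet_Iio (a := (0 : ℝ)))).1 h
      exact ae_iff.1 this
    have hpos : 0 < volume (Ioo (t - 1 / ((n : ℝ) + 1)) t) := by
      rw [Real.volume_Ioo]
      have : 0 < 1 / ((n : ℝ) + 1) := by positivity
      simpa using this
    have := measure_mono (μ := volume) hsub
    rw [hzero] at this
    exact absurd this (not_le.2 hpos)
  choose s hs hP using key
  refine ⟨s, hP, fun n => (hs n).2.trans ht, ?_⟩
  have h1 : Tendsto (fun n : ℕ => t - 1 / ((n : ℝ) + 1)) atTop (𝓝 t) := by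
    have : Tendsto (fun n : ℕ => 1 / ((n : ℝ) + 1)) atTop (𝓝 0) :=
      tendsto_one_div_add_atTop_nhds_zero_nat
    simpa using (tendsto_const_nhds (x := t)).sub this
  exact tendsto_of_tendsto_of_tendsto_of_le_of_le h1 tendsto_const_nhds
    (fun n => (hs n).1.le) (fun n => (hs n).2.le)

/-- **Hardy bound on EVERY slice of a continuous representative.** If `U` is jointly continuous on
the open slab `(−∞, 0) × ℝ³`, `u(t) = U(t)` a.e. for a.e. `t < 0`, and for every centre `x₀` the
Hardy bound `∫ |u(t)|²/|x − x₀| ≤ K` holds at a.e. `t`, then `∫ |U(t)|²/|x − x₀| ≤ K` for EVERY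
`t < 0` and every `x₀` (transfer along the a.e. equality, then Fatou along good times `t_n → t`,
the slices converging pointwise by joint continuity). [folklore] -/
theorem hardyPointSink_hardyEverySlice
    (u U : ℝ → EuclideanSpace ℝ (Fin 3) → EuclideanSpace ℝ (Fin 3)) (K : ℝ≥0)
    (hU : ContinuousOn (uncurry U) (Iio (0 : ℝ) ×ˢ (univ : Set (EuclideanSpace ℝ (Fin 3)))))
    (hae : ∀ᵐ t ∂(volume.restrict (Iio (0 : ℝ))), u t =ᵐ[volume] U t)
    (hK : ∀ x₀ : EuclideanSpace ℝ (Fin 3), ∀ᵐ t ∂(volume.restrict (Iio (0 : ℝ))),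
      ∫⁻ x, ‖u t x‖ₑ ^ 2 / ‖x - x₀‖ₑ ≤ K) :
    ∀ t < 0, ∀ x₀ : EuclideanSpace ℝ (Fin 3), ∫⁻ x, ‖U t x‖ₑ ^ 2 / ‖x - x₀‖ₑ ≤ K := by
  intro t ht x₀
  -- the bound holds for `U` at a.e. time
  have hgood : ∀ᵐ s ∂(volume.restrict (Iio (0 : ℝ))), ∫⁻ x, ‖U s x‖ₑ ^ 2 / ‖x - x₀‖ₑ ≤ K := by
    filter_upwards [hae, hK x₀] with s hs hKs
    calc ∫⁻ x, ‖U s x‖ₑ ^ 2 / ‖x - x₀‖ₑ = ∫⁻ x, ‖u s x‖ₑ ^ 2 / ‖x - x₀‖ₑ := by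
          refine lintegral_congr_ae ?_
          filter_upwards [hs] with x hx
          rw [hx]
      _ ≤ K := hKs
  obtain ⟨s, hsP, hsneg, hst⟩ := hardyPointSink_exists_seq_tendsto_of_ae_Iio hgood ht
  -- slices along the sequence converge pointwise
  have hpt : ∀ x, Tendsto (fun n => U (s n) x) atTop (𝓝 (U t x)) := by
    intro x
    have hcont : ContinuousAt (uncurry U) (t, x) :=
      hU.continuousAt ((isOpen_Iio.prod isOpen_univ).mem_nhds ⟨ht, mem_univ x⟩)
    have h2 : Tendsto (fun n => (s n, x)) atTop (𝓝 (t, x)) :=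
      hst.prodMk_nhds tendsto_const_nhds
    exact hcont.tendsto.comp h2
  -- continuity of slices (measurability)
  have hUsl : ∀ r < 0, Continuous (U r) := by
    intro r hr
    have h1 : ContinuousOn (fun x : EuclideanSpace ℝ (Fin 3) => ((r, x) : ℝ × EuclideanSpace ℝ (Fin 3)))
        univ := (Continuous.prodMk_right r).continuousOn
    have h2 : ContinuousOn (uncurry U ∘ fun x : EuclideanSpace ℝ (Fin 3) =>
        ((r, x) : ℝ × EuclideanSpace ℝ (Fin 3))) univ :=
      hU.comp h1 (fun x _ => ⟨hr, mem_univ x⟩)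
    exact continuousOn_univ.1 h2
  -- Fatou
  set f : ℕ → EuclideanSpace ℝ (Fin 3) → ℝ≥0∞ := fun n x => ‖U (s n) x‖ₑ ^ 2 / ‖x - x₀‖ₑ with hf
  have hfm : ∀ n, Measurable (f n) := by
    intro n
    have hc : Continuous (U (s n)) := hUsl (s n) (hsneg n)
    exact ((hc.measurable.enorm.pow_const 2).div (measurable_id.sub_const x₀).enorm)
  have hle : ∀ x, ‖U t x‖ₑ ^ 2 / ‖x - x₀‖ₑ ≤ liminf (fun n => f n x) atTop := by
    intro x
    have hnum : Tendsto (fun n => ‖U (s n) x‖ₑ ^ 2) atTop (𝓝 (‖U t x‖ₑ ^ 2)) :=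
      ((ENNReal.continuous_pow 2).tendsto _).comp ((continuous_enorm.tendsto _).comp (hpt x))
    by_cases h0 : ‖U t x‖ₑ ^ 2 = 0
    · rw [h0, ENNReal.zero_div]
      exact zero_le
    · have hlim : Tendsto (fun n => f n x) atTop (𝓝 (‖U t x‖ₑ ^ 2 / ‖x - x₀‖ₑ)) := by
        simp only [hf, div_eq_mul_inv]
        exact ENNReal.Tendsto.mul_const hnum (Or.inl h0)
      rw [hlim.liminf_eq]
  calc ∫⁻ x, ‖U t x‖ₑ ^ 2 / ‖x - x₀‖ₑ ≤ ∫⁻ x, liminf (fun n => f n x) atTop := lintegral_mono hle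
    _ ≤ liminf (fun n => ∫⁻ x, f n x) atTop := lintegral_liminf_le hfm
    _ ≤ K := by
        refine liminf_le_of_frequently_le' (Frequently.of_forall fun n => ?_)
        exact hsP n

/-- **The Liouville half of line `birth`, conditional on Albritton–Barker 2019 Thm 4.1** (stub
`stub_hardyWeakL3LiouvilleOfAB41` of the registered skeleton of the crux
`HardyPointSink.NoHardyTypeIAncient`). Under the named fact
`Literature.Analysis.FluidPDE.AlbrittonBarker2019_liouville_weakL3_backward`: a bounded ancient mild
solution `u` of Navier–Stokes (`ν = 1`, duality form) with a.e.-strongly measurable slices, jointly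
a.e.-strongly measurable on `(−∞, 0) × ℝ³`, with `∫ |u(t)|²/|x − x₀| ≤ K` for every centre `x₀` at
a.e. `t < 0`, and with `s³ · vol{s < |u(τ_k)|} ≤ M < ∞` for all `s > 0` along negative times
`τ_k → −∞`, satisfies `u(t) = 0` a.e. for a.e. `t < 0`. Proof: Oseen representative `U`
(`stub_hardyOseenWindow`, `stub_oseenAncientGluing`), Hardy on every slice of `U`
(`hardyPointSink_hardyEverySlice`), pinning of the constants at `τ_k` (`stub_weakL3Pinning`),
membership of every slice in `𝔹` (`stub_hardyLargeScale`), the fact at every final time `t₀ < 0`.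
[cite: AlbrittonBarker2019, Thm 4.1 (arXiv:1811.00502 §4 p. 9)] -/
theorem stub_hardyWeakL3LiouvilleOfAB41 :
    Literature.Analysis.FluidPDE.AlbrittonBarker2019_liouville_weakL3_backward →
    ∀ (u : ℝ → EuclideanSpace ℝ (Fin 3) → EuclideanSpace ℝ (Fin 3)),
      (∀ t < 0, AEStronglyMeasurable (u t) volume) →
      AEStronglyMeasurable (uncurry u)
        (volume.restrict (Iio (0 : ℝ) ×ˢ (univ : Set (EuclideanSpace ℝ (Fin 3))))) →
      Literature.Analysis.FluidPDE.IsBoundedAncientMildSolution 1 u →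
      (∃ K : ℝ≥0, ∀ x₀ : EuclideanSpace ℝ (Fin 3), ∀ᵐ t ∂(volume.restrict (Iio (0 : ℝ))),
        ∫⁻ x, ‖u t x‖ₑ ^ 2 / ‖x - x₀‖ₑ ≤ K) →
      (∃ (τ : ℕ → ℝ) (M : ℝ≥0∞), M < ⊤ ∧ Tendsto τ atTop atBot ∧ (∀ k, τ k < 0) ∧
        ∀ (k : ℕ) (s : ℝ), 0 < s →
          ENNReal.ofReal s ^ 3 * volume {x : EuclideanSpace ℝ (Fin 3) | s < ‖u (τ k) x‖} ≤ M) →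
      ∀ᵐ t ∂(volume.restrict (Iio (0 : ℝ))), u t =ᵐ[volume] 0 := by
  intro hF u hmeas hjoint hu hH hEnv
  unfold Literature.Analysis.FluidPDE.AlbrittonBarker2019_liouville_weakL3_backward at hF
  obtain ⟨K, hK⟩ := hH
  obtain ⟨τ, M, hM, hτ, hτneg, hweak⟩ := hEnv
  -- the ancient Oseen-mild representative
  obtain ⟨U, hUcont, ⟨C, hUC⟩, hUdiv, hUmild, hUae, hUall⟩ :=
    stub_oseenAncientGluing u hmeas hu
      (stub_hardyOseenWindow stub_hardyDriftConstant u hmeas hjoint hu ⟨K, hK⟩)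
  -- Hardy bound on every slice of `U`, every centre
  have hHU : ∀ t < 0, ∀ x₀ : EuclideanSpace ℝ (Fin 3), ∫⁻ x, ‖U t x‖ₑ ^ 2 / ‖x - x₀‖ₑ ≤ K :=
    hardyPointSink_hardyEverySlice u U K hUcont hUae hK
  -- slices of `U` are continuous, hence measurable
  have hUsl : ∀ t < 0, Continuous (U t) := by
    intro t ht
    have h1 : ContinuousOn (fun x : EuclideanSpace ℝ (Fin 3) => ((t, x) : ℝ × EuclideanSpace ℝ (Fin 3)))
        univ := (Continuous.prodMk_right t).continuousOn
    have h2 : ContinuousOn (uncurry U ∘ fun x : EuclideanSpace ℝ (Fin 3) =>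
        ((t, x) : ℝ × EuclideanSpace ℝ (Fin 3))) univ :=
      hUcont.comp h1 (fun x _ => ⟨ht, mem_univ x⟩)
    exact continuousOn_univ.1 h2
  -- pinning: the weak-L³ bound transfers to `U (τ k)`
  have hweakU : ∀ (k : ℕ) (s : ℝ), 0 < s →
      ENNReal.ofReal s ^ 3 * volume {x : EuclideanSpace ℝ (Fin 3) | s < ‖U (τ k) x‖} ≤ M := by
    intro k s hs
    obtain ⟨c, hc⟩ := hUall (τ k) (hτneg k)
    have hH0 : (∫⁻ x, ‖U (τ k) x‖ₑ ^ 2 / ‖x‖ₑ) < ⊤ := by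
      have h := hHU (τ k) (hτneg k) 0
      simp only [sub_zero] at h
      exact lt_of_le_of_lt h ENNReal.coe_lt_top
    have hc0 : c = 0 :=
      stub_weakL3Pinning (u (τ k)) (U (τ k)) c M C hM (hUsl (τ k) (hτneg k)).aestronglyMeasurable
        (fun x => hUC (τ k) (hτneg k) x) hH0 hc (hweak k)
    have hae : u (τ k) =ᵐ[volume] U (τ k) := by
      simpa [hc0] using hc
    have hset : {x : EuclideanSpace ℝ (Fin 3) | s < ‖U (τ k) x‖} =ᵐ[volume]
        {x : EuclideanSpace ℝ (Fin 3) | s < ‖u (τ k) x‖} := by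
      filter_upwards [hae] with x hx
      show (s < ‖U (τ k) x‖) = (s < ‖u (τ k) x‖)
      rw [hx]
    rw [measure_congr hset]
    exact hweak k s hs
  -- the fact at every final time `t₀ < 0`
  have hU0 : ∀ t < 0, ∀ x, U t x = 0 := by
    intro t₀ ht₀ x
    obtain ⟨hBesov, hResc⟩ :=
      stub_hardyLargeScale (U t₀) K C (hUsl t₀ ht₀).aestronglyMeasurable (fun y => hUC t₀ ht₀ y)
        (hHU t₀ ht₀)
    exact hF hUcont ⟨C, hUC⟩ hUdiv hUmild ⟨τ, M, hM, hτ, hτneg, hweakU⟩ ht₀ hBesov hResc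
      t₀ le_rfl x
  -- hence `u = 0` a.e. on a.e. slice
  filter_upwards [hUae, ae_restrict_mem measurableSet_Iio] with t ht htneg
  filter_upwards [ht] with x hx
  rw [hx, hU0 t htneg x]
  rfl

end Summit.NavierStokesRegularity.NavierStokesRegularity.Theorems

end
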